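import Summits.QuantumFields.YangMills.Theses.PlaquetteGasZeros
import Summits.QuantumFields.YangMills.Theorems.ThermodynamicCeilingsLargeVolumeCalibration
import HarnessLib

/-!
# Route `PlaquetteGasZeros` (planner ym-idea-11 g9, LINE 2 «PlaquetteGasZeros», lens «wuc»), assembly item (stmt-QuantumFields-23421)
# — BY NAME

`ZeroFreePolydisc → VietaExtraction → FloorsC → HypercubicOSDataFromInfiniteVolume`: the Vieta extraction turns the Lee–Yang /
Dobrushin zero-free polydisc of the plaquette-gas polynomial into the large-volume factorial sub-onset ceilings (the verbatim
hypothesis of `ThermodynamicCeilings.LargeVolumeCalibration`), and the LANDED calibration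
`ThermodynamicCeilings.largeVolumeCalibration_proof` (stmt-QuantumFields-27693) combines them with the onset floors `FloorsC`
(= `OnsetCalibration.OnsetFloors`) into the rung-R2a leaf.  Proof = the planner's λ-term.

Width seat ym-line-sfw-p2-w2 g23 (cell ym-idea-1; free hands).  HONEST FRAMING: `ZeroFreePolydisc` (Z1, open-problem) and `FloorsC`
(the programme's NT∧NG datum) are OPEN; this is plumbing of a draft route; no crux, rung or summit is proved and the Yang–Mills mass gap
is NOT proved.
-/

set_option autoImplicit false

namespace Summit.QuantumFields.YangMills.Theorems

/-- **`PlaquetteGasZeros.Assembly`** (item stmt-QuantumFields-23421) BY NAME: `ZeroFreePolydisc → VietaExtraction → FloorsC → leaf`,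
by the landed large-volume calibration `ThermodynamicCeilings.largeVolumeCalibration_proof` applied to the factorial ceilings
`hV hZ` and the floors `hF`. [folklore] -/
theorem plaquetteGasZeros_assembly_proof :
    Summit.QuantumFields.YangMills.Theses.PlaquetteGasZeros.Assembly :=
  fun hZ hV hF => Summit.QuantumFields.YangMills.Theorems.ThermodynamicCeilings.largeVolumeCalibration_proof (hV hZ) hF

end Summit.QuantumFields.YangMills.Theorems
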